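import Mathlib.CategoryTheory.SingleObj
import Mathlib.RingTheory.RootsOfUnity.Complex
import Mathlib.Analysis.Complex.Polynomial.Basic
import Literature.AnabelianGeometry.EtaleTheta.Discharge.Sec4NonVacuity
import HarnessLib

/-!
# [EtTh] §4 with a COVERING: the Kummer-tower toy setting (consistency witness, part 6 — data)

S. Mochizuki, *The étale theta function and its Frobenioid-theoretic manifestations*, Publ. RIMS **45**
(2009) [MochizukiEtTh2009], §4: setting of Definition 4.1 (PDF p.86), Prop 4.2 (iii) p.88 and its proof
p.89 ("over some tempered covering of `X^log` … `f` admits an `N`-th root" — ERRATUM E2, sub-node L01a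
`RootOverCovering` of `plan/L2/SUBDAG-EtTh-Prop42.md`).

CONSISTENCY WITNESS, TOY — the POSITIVE companion of this seat's countermodel `Toy.not_prop42_iii`
(p422428: at the cover-free, constant-free toy `B = t^ℤ`, Prop 4.2 (iii) fails).  Row «§4 TOY WITH A
COVERING» (abc-iut-L2-lead RULINGS #9 (R75), 2026-08-26).  This file holds the toy DATA (its `def`s are
objects: no `Prop`-valued definition, no named fact, no instance) and two REAL clauses about its units; the
sequel `Sec4NonVacuityCoveringRoots.lean` fires the sub-DAG's closers on it.  THE TOY ("monomials on
`𝔾_m/ℂ` with its Kummer self-covers"):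
* base `D = D₀ := CategoryTheory.SingleObj ℕ+` — ONE object `∗` with `End(∗) = (ℕ_{≥1}, ·)`, the
  endomorphism `N` being the Kummer cover `t ↦ t^N` (`ToyCov.cover`); `Aut(∗) = 1`; connected, totally
  epimorphic (cancellation in `ℕ+`);
* `Φ₀ = Φ₀^ℝ = Φ := ℚ_{≥0}`, pull-back along `N` = multiplication by `N` — perfect, `ℚ`-monoprime;
* `B₀ = B₀^Λ := ℂˣ × (ℚ_{≥0})^gp` ("constant × monomial `c·t^q`"), pull-back `(c, q) ↦ (c, N q)`, divisor map
  the second projection, `F := B` (Def 3.6 (ii)(b) REAL: `t` has divisor `𝔭 ≠ 0`); monoid type `Λ = ℤ`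
  (label; `B₀^Λ = B₀`);
* `A_⊙ := (∗, 0)`; `Π^tp_X ↠ G_K` trivial over `ℚ̄` (`Toy.temperedGroup`), `Π ↠ Aut_D(∗) = 1` surjective,
  every base object Galois, `(N, H)`-slot `True` — as in `Toy`.
WHY: (1) the CONSTANTS `ℂˣ ⊆ B` make every object `μ_N`-SATURATED for every `N` (REAL [FrdII] Def 2.1 (i):
`O^×(A) = ℂˣ`, `μ_N(A) =` the `N`-th roots of unity, cyclic of order `N` — `ToyCov.isMuSaturated`), as
Def 4.1 (iv)(a) / L01a demand and no constant-free toy can be for `N ≥ 2`; (2) along the pull-back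
morphism over the cover `N`, `f = c·t^q` pulls back to `c·t^{Nq} = (c^{1/N}·t^q)^N`, so L01a HOLDS (sequel).
HONEST LIMITS: one base object (the tower collapsed to its endomorphism monoid, so every base morphism is
FSM and pull-backs must be bijective — whence the divisible exponents `(ℚ_{≥0})^gp`, with which `N`-th roots
of `t^q` ALSO exist without a cover: the toy certifies JOINT SATISFIABILITY of the typed §4 inputs incl.
L01a and that the closers fire, NOT that covers are necessary — necessity of some extra input is p422428);
trivial [FrdI] vocabularies; not a curve; consistency ≠ faithfulness; typed ≠ proved.  Nothing here bears
on, or takes a side on, [IUTchIII] Cor. 3.12.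
-/

noncomputable section

namespace Literature.AnabelianGeometry.EtaleTheta

open CategoryTheory Opposite Literature.AlgebraicGeometry.Frobenioids
open scoped NNRat

namespace ToyCov

/-! ## The base: the monoid of Kummer endomorphisms of `𝔾_m` as a one-object category -/

/-- The base `D = D₀`: one object `∗`, `End(∗) = (ℕ_{≥1}, ·)` (Kummer covers). [cite: MochizukiEtTh2009, Def 3.3 p.73] -/
abbrev Base : Type := SingleObj ℕ+

/-- The object `∗`. [cite: MochizukiEtTh2009, Def 3.3 p.73] -/
abbrev pt : Base := SingleObj.star ℕ+

/-- The degree of a base morphism (its value in `ℕ_{≥1}`). [cite: MochizukiEtTh2009, Def 3.3 p.73] -/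
def deg {A B : Base} (f : A ⟶ B) : ℕ+ := f

/-- The Kummer cover of degree `N`, `t ↦ t^N`, as a base morphism. [cite: MochizukiEtTh2009, Prop 4.2 p.89] -/
def cover (A B : Base) (N : ℕ+) : A ⟶ B := N

/-- `deg (cover N) = N`. [cite: MochizukiEtTh2009, Def 3.6 p.76] -/
@[simp] theorem deg_cover (A B : Base) (N : ℕ+) : deg (cover A B N) = N := rfl

/-- Base morphisms are determined by their degree. [cite: MochizukiEtTh2009, Def 3.6 p.76] -/
theorem hom_eq {A B : Base} {f g : A ⟶ B} (h : deg f = deg g) : f = g := h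

/-- A base morphism with a right inverse is the identity (`ℕ_{≥1}` has trivial units). [folklore] -/
private theorem eq_id_of_comp_eq_id {A B : Base} {f : A ⟶ B} {g : B ⟶ A} (h : f ≫ g = 𝟙 A) : deg f = 1 := by
  have h' : (deg g : ℕ) * (deg f : ℕ) = 1 := by exact_mod_cast congrArg (fun x : ℕ+ => (x : ℕ)) (h : deg g * deg f = 1)
  exact PNat.coe_eq_one_iff.mp (Nat.eq_one_of_mul_eq_one_left h')

/-- `Aut_D(∗)` is trivial (so every base object is "Galois" with trivial group). [cite: MochizukiEtTh2009, Def 3.6 p.76] -/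
theorem aut_eq_one (A : Base) (σ : Aut A) : σ = 1 := by
  apply Aut.ext
  obtain rfl : A = pt := Subsingleton.elim _ _
  exact hom_eq (eq_id_of_comp_eq_id σ.hom_inv_id)

/-- "totally epimorphic": every base morphism is an epimorphism (cancellation in `ℕ_{≥1}`).
[cite: MochizukiEtTh2009, Def 3.6 p.76] -/
theorem epi (A B : Base) (f : A ⟶ B) : Epi f :=
  ⟨fun g h e => hom_eq (mul_right_cancel (e : deg g * deg f = deg h * deg f))⟩

/-- The trivial [FrdI] category vocabulary on the base. [cite: MochizukiEtTh2009, Def 3.6 p.77] -/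
def catVocab : FrdICatStub.{0, 0, 0} Base where
  IsDivisorialOn _ := True
  IsRational _ := True
  IsStrictlyRational _ := True

/-- The monoid `M` on the base, pull-back along a morphism of degree `N` being the `N`-th power map (the
divisor `[0]` pulls back to `N·[0]` along `t ↦ t^N`). [cite: MochizukiEtTh2009, Def 3.3 p.73] -/
def powFunctor (M : Type) [CommMonoid M] : Baseᵒᵖ ⥤ CommMonCat.{0} where
  obj _ := CommMonCat.of M
  map f := CommMonCat.ofHom (powMonoidHom ((deg f.unop : ℕ+) : ℕ))
  map_id A := by
    apply CommMonCat.hom_ext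
    ext x
    change x ^ ((1 : ℕ+) : ℕ) = x
    rw [PNat.one_coe, pow_one]
  map_comp f g := by
    apply CommMonCat.hom_ext
    ext x
    change x ^ ((deg f.unop * deg g.unop : ℕ+) : ℕ) = (x ^ (deg f.unop : ℕ)) ^ (deg g.unop : ℕ)
    rw [PNat.mul_coe, pow_mul]

/-- Pull-back in `powFunctor M` along `f` is `x ↦ x ^ deg f`. [cite: MochizukiEtTh2009, Def 3.3 p.73] -/
@[simp] theorem powFunctor_map_apply (M : Type) [CommMonoid M] {A B : Baseᵒᵖ} (f : A ⟶ B) (x : M) :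
    ((powFunctor M).map f).hom x = x ^ ((deg f.unop : ℕ+) : ℕ) := rfl

/-- On groupifications the `N`-th power map induces the `N`-th power map. [folklore] -/
private theorem gpMap_powMonoidHom (M : Type) [CommMonoid M] (N : ℕ) :
    gpMap (powMonoidHom N : M →* M) = powMonoidHom N := by
  apply Algebra.GrothendieckGroup.lift.symm.injective
  rw [Algebra.GrothendieckGroup.lift_symm_apply, Algebra.GrothendieckGroup.lift_symm_apply]
  ext m
  change gpMap (powMonoidHom N) (Algebra.GrothendieckGroup.of m) = Algebra.GrothendieckGroup.of m ^ N
  rw [gpMap_of, powMonoidHom_apply, map_pow]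

/-! ## The data `Φ₀ = ℚ_{≥0}`, `B₀ = ℂˣ × (ℚ_{≥0})^gp` -/

/-- `B₀(∗) = B₀^Λ(∗)`: constants times monomials, `ℂˣ × (ℚ_{≥0})^gp`. [cite: MochizukiEtTh2009, Def 3.3 p.73] -/
abbrev Fn : Type := ℂˣ × Algebra.GrothendieckGroup (Multiplicative ℚ≥0)

/-- `B₀` as a functor: pull-back along a morphism of degree `N` is `(c, q) ↦ (c, N q)` (constants stay
constant, `t ↦ t^N`). [cite: MochizukiEtTh2009, Def 3.3 p.73] -/
def fnFunctor : Baseᵒᵖ ⥤ CommMonCat.{0} where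
  obj _ := CommMonCat.of Fn
  map f := CommMonCat.ofHom (MonoidHom.prodMap (MonoidHom.id ℂˣ) (powMonoidHom ((deg f.unop : ℕ+) : ℕ)))
  map_id A := by
    apply CommMonCat.hom_ext
    ext x
    · rfl
    · change x.2 ^ ((1 : ℕ+) : ℕ) = x.2
      rw [PNat.one_coe, pow_one]
  map_comp f g := by
    apply CommMonCat.hom_ext
    ext x
    · rfl
    · change x.2 ^ ((deg f.unop * deg g.unop : ℕ+) : ℕ) = (x.2 ^ (deg f.unop : ℕ)) ^ (deg g.unop : ℕ)
      rw [PNat.mul_coe, pow_mul]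

/-- Pull-back in `B₀` along `f`. [cite: MochizukiEtTh2009, Def 3.3 p.73] -/
@[simp] theorem fnFunctor_map_apply {A B : Baseᵒᵖ} (f : A ⟶ B) (x : Fn) :
    (fnFunctor.map f).hom x = (x.1, x.2 ^ ((deg f.unop : ℕ+) : ℕ)) := rfl

/-- **Def 3.3 (iii) data of the Kummer-tower toy**: `Φ₀ = ℚ_{≥0}`, `B₀ = ℂˣ × (ℚ_{≥0})^gp`, divisor map the
second projection, `F₀ = B₀`, everything non-cuspidal. [cite: MochizukiEtTh2009, Def 3.3 p.73] -/
def divisorMonoids : DivisorMonoids.{0, 0, 0} Base where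
  Φ₀ := powFunctor (Multiplicative ℚ≥0)
  B₀ := fnFunctor
  isUnit_B₀ _ b := by
    change IsUnit (M := Fn) b
    exact Group.isUnit _
  div₀ _ := MonoidHom.snd _ _
  div₀_natural f b := by
    change b.2 ^ ((deg f.unop : ℕ+) : ℕ) =
      gpMap (powMonoidHom ((deg f.unop : ℕ+) : ℕ) : Multiplicative ℚ≥0 →* Multiplicative ℚ≥0) b.2
    rw [gpMap_powMonoidHom]
    rfl
  F₀ _ := ⊤
  F₀_map _ _ _ := trivial
  ncsp₀ _ := ⊤
  csp₀ _ := ⊥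
  ncsp₀_map _ _ _ := trivial
  csp₀_map f x hx := by
    rw [Submonoid.mem_bot] at hx ⊢
    rw [hx, map_one]
  existsUnique_ncsp_csp _ x := by
    refine ⟨(⟨x, trivial⟩, ⟨1, Submonoid.mem_bot.mpr rfl⟩), mul_one x, ?_⟩
    rintro ⟨a, c⟩ h
    have hc : c.1 = 1 := Submonoid.mem_bot.mp c.2
    have ha : a.1 = x := by
      have h' : a.1 * c.1 = x := h
      rwa [hc, mul_one] at h'
    exact Prod.ext (Subtype.ext ha) (Subtype.ext hc)

/-- **Def 3.6 (i) data of the Kummer-tower toy** (`Λ = ℤ`, `Φ₀^ℝ = Φ₀`, `B₀^Λ = B₀`, `F₀^Λ = B₀`,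
`ℝ·Φ₀^cnst =` everything), over the trivial monoid vocabulary. [cite: MochizukiEtTh2009, Def 3.6 p.76] -/
def realified : RealifiedDivisorMonoids (D₀ := Base) Toy.monoidVocab where
  toDivisorMonoids := divisorMonoids
  Λ := MonoidType.Z
  ΦR := powFunctor (Multiplicative ℚ≥0)
  toR _ := MonoidHom.id _
  toR_natural _ _ := rfl
  isRealification _ := trivial
  BΛ := fnFunctor
  isUnit_BΛ _ b := by
    change IsUnit (M := Fn) b
    exact Group.isUnit _
  divΛ _ := MonoidHom.snd _ _
  divΛ_natural f b := by
    change b.2 ^ ((deg f.unop : ℕ+) : ℕ) =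
      gpMap (powMonoidHom ((deg f.unop : ℕ+) : ℕ) : Multiplicative ℚ≥0 →* Multiplicative ℚ≥0) b.2
    rw [gpMap_powMonoidHom]
    rfl
  FΛ _ := ⊤
  FΛ_map _ _ _ := trivial
  cnstR _ := ⊤
  cnstR_map _ _ _ := trivial
  divΛ_mem_cnstR _ _ _ := trivial
  cnstR_root _ _ _ _ := trivial
  cnst_le_cnstR _ _ _ := trivial
  ncspR _ := ⊤
  cspR _ := ⊥
  toR_ncsp _ _ _ := trivial
  toR_csp _ _ hx := hx

/-- **Def 3.6 (ii), the Kummer-tower toy tempered Frobenioid**: `D → D₀` the identity, `Φ = Φ^{ℝ-log} =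
ℚ_{≥0}` (group-saturated, perfect), `Φ^{bs-fld} = ℚ_{≥0}` monoprime (REAL), and `t = (1, 𝔭) ∈ F` has divisor
`𝔭 ≠ 0` (condition (b), REAL). [cite: MochizukiEtTh2009, Def 3.6 p.77] -/
def temperedFrobenioid : TemperedFrobenioid realified Base catVocab where
  isConnected := zigzag_isConnected fun j₁ j₂ => by rw [Subsingleton.elim j₁ j₂]
  isTotallyEpimorphic := ⟨fun f => epi _ _ f⟩
  base := 𝟭 _
  Φ := ⟨fun _ => ⊤, fun _ _ _ => trivial⟩
  isGroupSaturated A := (isGroupSaturated_iff' _).2 fun _ _ _ _ _ _ => trivial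
  isPerfFactorial _ := trivial
  isDivisorialOn := trivial
  isMonoprime_bsFld A := Toy.isMonoprime_of_eq_top_nnrat
    (eq_top_iff.2 fun x _ => Submonoid.mem_inf.2 ⟨Submonoid.mem_top x,
      (Subgroup.mem_top (Algebra.GrothendieckGroup.of x) :
        Algebra.GrothendieckGroup.of x ∈
          (⊤ : Subgroup (Algebra.GrothendieckGroup (Multiplicative ℚ≥0))))⟩)
  exists_FΛ_div_ne A := ⟨((1 : ℂˣ), Algebra.GrothendieckGroup.of (Multiplicative.ofAdd (1 : ℚ≥0))), trivial,
    (Multiplicative.ofAdd (1 : ℚ≥0) : Multiplicative ℚ≥0), trivial, (1 : Multiplicative ℚ≥0), trivial,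
    fun h => one_ne_zero (Multiplicative.ofAdd.injective h), by
      change Algebra.GrothendieckGroup.of (M := Multiplicative ℚ≥0) (Multiplicative.ofAdd 1) =
        Algebra.GrothendieckGroup.of (M := Multiplicative ℚ≥0) (Multiplicative.ofAdd 1) /
          Algebra.GrothendieckGroup.of (M := Multiplicative ℚ≥0) 1
      rw [(Algebra.GrothendieckGroup.of (M := Multiplicative ℚ≥0)).map_one, div_one]⟩

/-- "whose monoid type is `ℤ`". [cite: MochizukiEtTh2009, Def 4.1 p.86] -/
theorem temperedFrobenioid_monoidType : temperedFrobenioid.monoidType = MonoidType.Z := rfl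

/-- "whose divisor monoid `Φ` is perfect": `Φ(A) = ℚ_{≥0}`. [cite: MochizukiEtTh2009, Def 4.1 p.86] -/
theorem temperedFrobenioid_isPerfect (A : Baseᵒᵖ) : IsPerfect (temperedFrobenioid.Φ.carrier A) :=
  isPerfect_of_mulEquiv_nnrat (N := ↥(⊤ : Submonoid (Multiplicative ℚ≥0))) Submonoid.topEquiv

/-- `B` is objectwise group-like. [cite: MochizukiEtTh2009, Def 3.6 p.77] -/
theorem ratFnFunctor_isGroupLike :
    Objectwise (fun M _ => IsGroupLike M) temperedFrobenioid.ratFnFunctor :=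
  temperedFrobenioid.ratFnFunctor_isGroupLike realified.isUnit_BΛ

/-- `Φ = ℚ_{≥0}` is objectwise divisorial (monoprime). [cite: MochizukiEtTh2009, Def 3.6 p.77] -/
theorem divisorMonoid_isDivisorial :
    Objectwise (fun M _ => IsDivisorial M) temperedFrobenioid.divisorMonoid :=
  fun _ => (Toy.isMonoprime_of_eq_top_nnrat (S := (⊤ : Submonoid (Multiplicative ℚ≥0))) rfl).isDivisorial

/-! ## The §4 setting over the Kummer-tower toy -/

/-- `A_⊙ := (∗, 0)`. [cite: MochizukiEtTh2009, Def 4.1 p.86] -/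
def Aodot : temperedFrobenioid.category :=
  ModelFrobenioid.zeroObj _ _ _ pt

/-- `A_⊙` is Frobenius-trivial (L1's [FrdI] Thm 5.2 proof step). [cite: MochizukiEtTh2009, Def 4.1 p.86] -/
theorem isFrobeniusTrivial_Aodot :
    PreFrobenioid.IsFrobeniusTrivial temperedFrobenioid.toElem Aodot :=
  ModelFrobenioid.isFrobeniusTrivial_zeroObj ratFnFunctor_isGroupLike _

/-- `Π^tp_X ↠ Aut_D(A^bs) = 1`, the trivial homomorphism, is surjective. [cite: MochizukiEtTh2009, Def 4.1 p.86] -/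
theorem galoisSurj_surjective (A : Base) (_h : True) :
    Function.Surjective ((1 : Toy.temperedGroup.Pi →* Aut A) : Toy.temperedGroup.Pi → Aut A) :=
  fun σ => ⟨1, by rw [MonoidHom.one_apply, aut_eq_one A σ]⟩

/-- **The §4 setting WITH COVERINGS**: the `BiKummerSetting` over the Kummer-tower toy, through
abc-iut-L2-t9's canonical model constructor `mkOfModelCanonical` (Galois objects := all,
`Π^tp_X ↠ Aut_D(A^bs)` := trivial, `(N,H)`-slot := `True`, `A_⊙ := (∗, 0)`). [cite: MochizukiEtTh2009, Def 4.1 p.86] -/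
def biKummerSetting : BiKummerSetting Toy.temperedGroup realified Base catVocab :=
  BiKummerSetting.mkOfModelCanonical Toy.temperedGroup temperedFrobenioid temperedFrobenioid_monoidType
    temperedFrobenioid_isPerfect (fun _ => True) (fun _ _ => 1) galoisSurj_surjective (fun _ _ _ => True)
    Aodot isFrobeniusTrivial_Aodot trivial


/-! ## Units of the Kummer-tower toy: `O^×(A) ≅ ℂˣ`, every object is `μ_N`-saturated for every `N` -/

section Units

variable (A : temperedFrobenioid.category)

/-- Every automorphism of an object of the toy Frobenioid is a unit: its base part is an automorphism of
`∗`, hence `1`, and isomorphisms have Frobenius degree `1`. [cite: MochizukiFrdI2008, Thm. 5.2(ii) p.101] -/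
theorem mem_units (σ : Aut A) : σ ∈ ModelFrobenioid.units A := by
  refine ⟨?_, (ModelFrobenioid.degFr_hom_eq_one σ).1⟩
  have h : ModelFrobenioid.baseMap σ.hom ≫ ModelFrobenioid.baseMap σ.inv = 𝟙 _ := by
    rw [← ModelFrobenioid.baseMap_comp, σ.hom_inv_id, ModelFrobenioid.baseMap_id]
  exact hom_eq (eq_id_of_comp_eq_id h)

/-- The constant `c ∈ ℂˣ` as a rational function on `A^bs` (divisor `0`). [cite: MochizukiEtTh2009, Def 3.6 p.77] -/
def cnst (c : ℂˣ) : temperedFrobenioid.ratFnFunctor.obj (op A.base) :=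
  ⟨(((c, 1) : Fn), 1), by
    change (1 : Algebra.GrothendieckGroup (Multiplicative ℚ≥0)) = temperedFrobenioid.ΦgpToRlog _ 1
    exact (map_one _).symm⟩

/-- The constants as a homomorphism `ℂˣ → B(A^bs)^×`. [cite: MochizukiEtTh2009, Def 3.6 p.77] -/
def cnstUnitHom : ℂˣ →* (temperedFrobenioid.ratFnFunctor.obj (op A.base))ˣ where
  toFun c := ⟨cnst A c, cnst A c⁻¹,
    Subtype.ext (Prod.ext (Prod.ext (mul_inv_cancel c) (mul_one _)) (mul_one _)),
    Subtype.ext (Prod.ext (Prod.ext (inv_mul_cancel c) (mul_one _)) (mul_one _))⟩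
  map_one' := Units.ext (Subtype.ext rfl)
  map_mul' _ _ := Units.ext (Subtype.ext (Prod.ext (Prod.ext rfl (mul_one _).symm) (mul_one _).symm))

/-- `cnstUnitHom` is injective (constants embed in `B(A^bs)^×`). [cite: MochizukiFrdI2008, Thm. 5.2(ii) p.101] -/
theorem cnstUnitHom_injective : Function.Injective (cnstUnitHom A) := fun _ _ h =>
  congrArg (fun u : (temperedFrobenioid.ratFnFunctor.obj (op A.base))ˣ =>
    (u : temperedFrobenioid.ratFnFunctor.obj (op A.base)).1.1.1) h

/-- `0 = Div_B(c)` for a constant. [cite: MochizukiFrdI2008, Thm. 5.2(i) p.100] -/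
theorem of_one_eq_divB_cnst (c : ℂˣ) :
    Algebra.GrothendieckGroup.of (1 : temperedFrobenioid.divisorMonoid.obj (op A.base)) =
      divB temperedFrobenioid.divisorMonoid temperedFrobenioid.ratFnFunctor
        temperedFrobenioid.divBNatTrans (op A.base) (cnst A c) := by
  rw [map_one]
  rfl

/-- **"Multiplication by the constant `c`"**: the unit automorphism `(1, id, 0, c) ∈ O^×(A)` (L1's
`ModelFrobenioid.unitAut`). [cite: MochizukiFrdI2008, Thm. 5.2(ii) p.101] -/
def coefAut (c : ℂˣ) : Aut A :=
  ModelFrobenioid.unitAut A 1 1 (cnst A c) (cnst A c⁻¹) (of_one_eq_divB_cnst A c) (of_one_eq_divB_cnst A c⁻¹)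
    (one_mul 1) (Subtype.ext (Prod.ext (Prod.ext (inv_mul_cancel c) (mul_one _)) (mul_one _)))

/-- `coefAut c ∈ O^×(A)`. [cite: MochizukiFrdI2008, Thm. 5.2(ii) p.101] -/
theorem coefAut_mem_units (c : ℂˣ) : coefAut A c ∈ ModelFrobenioid.units A :=
  ModelFrobenioid.unitAut_mem_units _ _ _ _ _ _ _ _ _

/-- `coefAut c` as an element of `O^×(A)`. [cite: MochizukiFrdI2008, Thm. 5.2(ii) p.101] -/
def coefUnit (c : ℂˣ) : ModelFrobenioid.units A := ⟨coefAut A c, coefAut_mem_units A c⟩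

/-- Under `O^×(A) ↪ B(A^bs)^×` ([FrdI] Thm 5.2 (ii)) `coefAut c ↦ c`. [cite: MochizukiFrdI2008, Thm. 5.2(ii) p.101] -/
theorem unitsToRatFn_coefUnit (c : ℂˣ) :
    ModelFrobenioid.unitsToRatFn A (coefUnit A c) = cnstUnitHom A c :=
  Units.ext rfl

/-- **`O^×(A) = ℂˣ`**: every unit of `A` is multiplication by a constant — its rational function `u` has
`Div_B(u) = 0` (`Φ` sharp), hence monomial part `0`. [cite: MochizukiFrdI2008, Thm. 5.2(ii) p.101] -/
theorem exists_eq_cnstUnitHom (τ : ModelFrobenioid.units A) :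
    ∃ c : ℂˣ, ModelFrobenioid.unitsToRatFn A τ = cnstUnitHom A c := by
  have h2 : (ModelFrobenioid.unitsToRatFn A τ : temperedFrobenioid.ratFnFunctor.obj (op A.base)).1.2 = 1 :=
    ModelFrobenioid.divB_unitsToRatFn_eq_one (divisorMonoid_isDivisorial A.base).isSharp τ
  have h12 : (ModelFrobenioid.unitsToRatFn A τ : temperedFrobenioid.ratFnFunctor.obj (op A.base)).1.1.2 = 1 := by
    have hrel := (ModelFrobenioid.unitsToRatFn A τ : temperedFrobenioid.ratFnFunctor.obj (op A.base)).2
    change (_ : Algebra.GrothendieckGroup (Multiplicative ℚ≥0)) = temperedFrobenioid.ΦgpToRlog _ _ at hrel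
    rw [h2, map_one] at hrel
    exact hrel
  exact ⟨(ModelFrobenioid.unitsToRatFn A τ : temperedFrobenioid.ratFnFunctor.obj (op A.base)).1.1.1,
    Units.ext (Subtype.ext (Prod.ext (Prod.ext rfl h12) h2))⟩

/-- `O^×(A) ↪ B(A^bs)^×` is injective here (`Φ = ℚ_{≥0}` integral). [cite: MochizukiFrdI2008, Thm. 5.2(ii) p.101] -/
theorem unitsToRatFn_injective : Function.Injective (ModelFrobenioid.unitsToRatFn A) :=
  ModelFrobenioid.unitsToRatFn_injective (divisorMonoid_isDivisorial A.base).isPreDivisorial.isIntegral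

/-- **Every object of the Kummer-tower toy is `μ_N`-saturated, for every `N`** (REAL [FrdII] Def 2.1 (i)):
`μ_N(A) ⊆ O^×(A) = ℂˣ` is the group of `N`-th roots of unity, cyclic of order `N`, generated by
`exp(2πi/N)`. [cite: MochizukiEtTh2009, Def 4.1 p.87] -/
theorem isMuSaturated (N : ℕ+) : temperedFrobenioid.IsMuSaturated A N := by
  have hN : (N : ℕ) ≠ 0 := PNat.ne_zero N
  have hζ := Complex.isPrimitiveRoot_exp N hN
  have hζu : IsPrimitiveRoot (hζ.isUnit hN).unit N := hζ.isUnit_unit hN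
  set ζu : ℂˣ := (hζ.isUnit hN).unit
  have hinj := unitsToRatFn_injective A
  have hord : orderOf (coefUnit A ζu) = (N : ℕ) := by
    rw [← orderOf_injective _ hinj (coefUnit A ζu), unitsToRatFn_coefUnit,
      orderOf_injective _ (cnstUnitHom_injective A) ζu]
    exact hζu.eq_orderOf.symm
  refine ⟨(coefUnit A ζu : Aut A), ⟨⟨(coefAut_mem_units A ζu).1, (coefAut_mem_units A ζu).2⟩, ?_⟩, ?_, ?_⟩
  · have h := congrArg Subtype.val (pow_orderOf_eq_one (coefUnit A ζu))
    rwa [hord, SubmonoidClass.coe_pow] at h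
  · rw [show (coefUnit A ζu : Aut A) = ((coefUnit A ζu : ModelFrobenioid.units A) : Aut A) from rfl,
      Subgroup.orderOf_coe, hord]
  · rintro τ ⟨hτu, hτN⟩
    let τu : ModelFrobenioid.units A := ⟨τ, hτu.1, hτu.2⟩
    obtain ⟨c, hc⟩ := exists_eq_cnstUnitHom A τu
    have hτuN : τu ^ (N : ℕ) = 1 := Subtype.ext (by rw [SubmonoidClass.coe_pow]; exact hτN)
    have hcN : c ^ (N : ℕ) = 1 := cnstUnitHom_injective A (by
      rw [map_pow, ← hc, ← map_pow, hτuN, map_one, map_one])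
    have hcmem : c ∈ Subgroup.zpowers ζu := by
      rw [hζu.zpowers_eq]
      exact (mem_rootsOfUnity _ c).2 hcN
    obtain ⟨i, hi⟩ := Subgroup.mem_zpowers_iff.mp hcmem
    have hτu' : (coefUnit A ζu) ^ i = τu :=
      hinj (by rw [map_zpow, unitsToRatFn_coefUnit, ← map_zpow, hi, hc])
    exact Subgroup.mem_zpowers_iff.mpr ⟨i, by
      have h := congrArg Subtype.val hτu'
      rwa [SubgroupClass.coe_zpow] at h⟩

end Units

/-- **The §4 setting WITH COVERINGS is inhabited, with REAL `μ_N`-saturation**: over the Kummer-tower toy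
there is a `BiKummerSetting` (through `mkOfModelCanonical`) every object of whose Frobenioid is
`μ_N`-saturated for every `N ≥ 1`. [cite: MochizukiEtTh2009, Def 4.1 p.87] -/
theorem nonempty_biKummerSetting_muSaturated :
    ∃ S : BiKummerSetting Toy.temperedGroup realified Base catVocab, ∀ (A : S.C) (N : ℕ+), S.IsMuSaturated A N :=
  ⟨biKummerSetting, fun A N => isMuSaturated A N⟩

end ToyCov

end Literature.AnabelianGeometry.EtaleTheta

end
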